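import Mathlib.Analysis.Calculus.MeanValue
import Mathlib.Analysis.Calculus.IteratedDeriv.Lemmas
import Mathlib.Analysis.Calculus.ContDiff.Basic
import HarnessLib

/-!
# The symmetric second difference of a `C²` function is `O(s²)`

Topic `Literature/Analysis/Calculus`. For `f : ℝ → E` of class `C²` with `‖f''‖ ≤ M` on `[-1, 1]`,

  `‖f(s) + f(-s) - 2 f(0)‖ ≤ 2 M s²`  for `|s| ≤ 1`

(`symm_second_diff_le`): the function `g(u) = f(u) + f(-u) - 2f(0)` has `g(0) = 0` and
`g'(u) = f'(u) - f'(-u)`, of norm `≤ 2M|u|` by the mean value inequality for `f'`, and a second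
application of the mean value inequality gives the claim. In particular an EVEN `C²` function
vanishing at `0` is `O(s²)` with an explicit constant (`norm_le_of_even_of_eq_zero`). This is the
elementary calculus step of Benfatto–Giuliani–Mastropietro's Lemma 2.2a (the scale-parameter
integral of the master symbol is even and vanishes at scale zero). Everything is PROVED. [folklore]
-/

noncomputable section

open Set

namespace Literature.Analysis.Calculus

variable {E : Type*} [NormedAddCommGroup E] [NormedSpace ℝ E]

/-- For `C²` functions, `deriv f` is differentiable with derivative `iteratedDeriv 2 f`. [folklore] -/
theorem hasDerivAt_deriv_of_contDiff_two {f : ℝ → E} (hf : ContDiff ℝ 2 f) (x : ℝ) :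
    HasDerivAt (deriv f) (iteratedDeriv 2 f x) x := by
  have h1 : ContDiff ℝ 1 (deriv f) := by
    have := hf.iterate_deriv' 1 1
    simpa using this
  have hd : DifferentiableAt ℝ (deriv f) x := (h1.differentiable one_ne_zero).differentiableAt
  rw [iteratedDeriv_succ, iteratedDeriv_one]
  exact hd.hasDerivAt

/-- **Mean value bound for `f'`**: `‖f'(y) - f'(x)‖ ≤ M |y - x|` on `[-1,1]` if `‖f''‖ ≤ M` there. [folklore] -/
theorem norm_deriv_sub_deriv_le {f : ℝ → E} (hf : ContDiff ℝ 2 f) {M : ℝ}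
    (hM : ∀ u ∈ Icc (-1 : ℝ) 1, ‖iteratedDeriv 2 f u‖ ≤ M) {x y : ℝ} (hx : x ∈ Icc (-1 : ℝ) 1) (hy : y ∈ Icc (-1 : ℝ) 1) :
    ‖deriv f y - deriv f x‖ ≤ M * ‖y - x‖ := by
  refine (convex_Icc (-1 : ℝ) 1).norm_image_sub_le_of_norm_deriv_le (f := deriv f)
    (fun u _ => (hasDerivAt_deriv_of_contDiff_two hf u).differentiableAt) (fun u hu => ?_) hx hy
  rw [(hasDerivAt_deriv_of_contDiff_two hf u).deriv]
  exact hM u hu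

/-- **The symmetric second difference bound**: `‖f(s) + f(-s) - 2f(0)‖ ≤ 2M s²` for `|s| ≤ 1`, if `f`
is `C²` with `‖f''‖ ≤ M` on `[-1, 1]`. [folklore] -/
theorem symm_second_diff_le {f : ℝ → E} (hf : ContDiff ℝ 2 f) {M : ℝ}
    (hM : ∀ u ∈ Icc (-1 : ℝ) 1, ‖iteratedDeriv 2 f u‖ ≤ M) {s : ℝ} (hs : s ∈ Icc (-1 : ℝ) 1) :
    ‖f s + f (-s) - (2 : ℝ) • f 0‖ ≤ 2 * M * s ^ 2 := by
  have hM0 : 0 ≤ M := (norm_nonneg _).trans (hM 0 ⟨by norm_num, by norm_num⟩)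
  set g : ℝ → E := fun u => f u + f (-u) - (2 : ℝ) • f 0 with hg
  have hfd : ∀ u, HasDerivAt f (deriv f u) u := fun u =>
    ((hf.differentiable (by norm_num)).differentiableAt).hasDerivAt
  have hgd : ∀ u, HasDerivAt g (deriv f u - deriv f (-u)) u := fun u => by
    have h1 := hfd u
    have h2 : HasDerivAt (fun u => f (-u)) (-deriv f (-u)) u := by
      have := (hfd (-u)).scomp u (hasDerivAt_neg' u)
      simpa [Function.comp_def] using this
    have := (h1.add h2).sub_const ((2 : ℝ) • f 0)
    simpa [hg, sub_eq_add_neg] using this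
  -- on the segment between `0` and `s`, `‖g'‖ ≤ 2M|s|`
  set S : Set ℝ := uIcc 0 s with hS
  have hSsub : S ⊆ Icc (-1 : ℝ) 1 := by
    rw [hS]; exact uIcc_subset_Icc ⟨by norm_num, by norm_num⟩ hs
  have hbound : ∀ u ∈ S, ‖deriv g u‖ ≤ 2 * M * |s| := fun u hu => by
    rw [(hgd u).deriv]
    have hu1 : u ∈ Icc (-1 : ℝ) 1 := hSsub hu
    have hu2 : -u ∈ Icc (-1 : ℝ) 1 := ⟨by linarith [hu1.2], by linarith [hu1.1]⟩
    have hus : |u| ≤ |s| := by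
      rw [hS, mem_uIcc] at hu
      rcases hu with ⟨h0, h1⟩ | ⟨h0, h1⟩
      · rw [abs_of_nonneg h0, abs_of_nonneg (h0.trans h1)]; exact h1
      · rw [abs_of_nonpos h1, abs_of_nonpos (h0.trans h1)]; linarith
    calc ‖deriv f u - deriv f (-u)‖ ≤ M * ‖u - -u‖ := norm_deriv_sub_deriv_le hf hM hu2 hu1
      _ = 2 * M * |u| := by rw [sub_neg_eq_add, ← two_mul, norm_mul, Real.norm_eq_abs, Real.norm_eq_abs, abs_two]; ring
      _ ≤ 2 * M * |s| := by gcongr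
  have hmvt := (convex_uIcc (0 : ℝ) s).norm_image_sub_le_of_norm_deriv_le (f := g)
    (fun u _ => (hgd u).differentiableAt) hbound (left_mem_uIcc) (right_mem_uIcc)
  have hg0 : g 0 = 0 := by simp [hg, two_smul]
  rw [hg0, sub_zero, sub_zero, Real.norm_eq_abs] at hmvt
  calc ‖f s + f (-s) - (2 : ℝ) • f 0‖ = ‖g s‖ := rfl
    _ ≤ 2 * M * |s| * |s| := hmvt
    _ = 2 * M * s ^ 2 := by rw [mul_assoc, ← sq, sq_abs]

/-- **An even `C²` function vanishing at `0` is `O(s²)`**: `‖f(s)‖ ≤ M s²` for `|s| ≤ 1`. [folklore] -/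
theorem norm_le_of_even_of_eq_zero {f : ℝ → E} (hf : ContDiff ℝ 2 f) {M : ℝ}
    (hM : ∀ u ∈ Icc (-1 : ℝ) 1, ‖iteratedDeriv 2 f u‖ ≤ M) (heven : ∀ u, f (-u) = f u) (h0 : f 0 = 0)
    {s : ℝ} (hs : s ∈ Icc (-1 : ℝ) 1) : ‖f s‖ ≤ M * s ^ 2 := by
  have h := symm_second_diff_le hf hM hs
  rw [heven, h0, smul_zero, sub_zero, ← two_smul ℝ, norm_smul, Real.norm_eq_abs, abs_two] at h
  linarith

end Literature.Analysis.Calculus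

end
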